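import Summits.ValiantsHypothesis.ValiantsHypothesis.Theses.FeketeSOS

/-!
# `SOSMagnification` / `FeketeSOSHard` — negative lemmas: imprimitive NON-principal characters are SOS-easy

Companion of `FeketePrimePowerModuli.lean` (standing-disprover findings, cycle 3, crux
`stmt-ValiantsHypothesis-3995`; work file `Cruxes/SOSMagnification/Disproof.lean`).  There the odd-modulus
version of X = `FeketeSOSHard` (Legendre symbol read as Jacobi symbol) is refuted through the PRINCIPAL character
of a prime-square modulus.  Here the same is done for NON-PRINCIPAL characters, at every `δ > 0`:

* `charDigits_mul_topDigits`, `odd_prime_pow_digit_split`: for the imprimitive character `(·|q)` to the modulus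
  `q^(2j+1)`, `∑_{m<q^(2j+1)} (m|q^(2j+1)) X^m = (∑_{u<q^(j+1)} (u|q) X^u)·(∑_{t<q^j} X^{q^(j+1) t})` — two factors of
  sparsity `≤ q^(j+1)`, `≤ q^j` (the inverse multilinear Kronecker substitution of the magnification step, run
  backwards);
* `nonprincipal_slice_to_legendre_slice`: the δ-slice of X over odd moduli whose Jacobi character takes the
  value `−1` implies X's δ-slice (primes `≥ 3` qualify: `exists_jacobiSym_eq_neg_one`), so it is a strengthening;
* `feketeSOSHard_slice_false_nonprincipal`: and it is FALSE for every `δ > 0` — with `2jδ ≥ 1` and a prime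
  `q ≥ 17`, `p = q^(2j+1)` admits `F_p = ¼(U+V)² − ¼(U−V)²` with `s = 2 ≤ p^δ` squares of degree `≤ p` and
  support-sum `≤ 4q^(j+1) < q^(j+1)·q^(1/2) ≤ p^(1/2+δ)`.

So any proof of X must use that `χ_p` is PRIMITIVE of conductor `p`, not merely a non-principal real
multiplicative `{0,±1}`-valued sequence; and since all witnesses are splittings (`s = 2`), the odd-modulus
analogues of `FeketeNoSparseSplit` / `FeketeBoundedFanin` fail as well.

References: P. Dutta, N. Saxena, T. Thierauf, comput. complexity 33 (2024), Def. 1.1, §3.1 (eq. (7)–(8))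
[DuttaSaxenaThierauf2024]; the lemmas are folklore algebra and elementary number theory (Mathlib `jacobiSym`,
`FiniteField.exists_nonsquare`).
-/

namespace Summit.ValiantsHypothesis.ValiantsHypothesis.Theorems.SOSMagnification.Negative

set_option linter.dupNamespace false

open Polynomial
open scoped BigOperators

/-! ### Non-principal imprimitive characters at EVERY δ: odd prime powers `q^(2j+1)` -/

/-- `(m | n^(2j+1)) = (m | n)` for the Jacobi symbol. [folklore] -/
theorem jacobiSym_odd_pow (m n j : ℕ) : jacobiSym m (n ^ (2 * j + 1)) = jacobiSym m n := by
  rw [jacobiSym.pow_right]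
  rcases jacobiSym.trichotomy (m : ℤ) n with h | h | h <;> rw [h]
  · exact zero_pow (by omega)
  · exact one_pow _
  · exact Odd.neg_one_pow ⟨j, rfl⟩

/-- **Digit splitting of an imprimitive character.**
`(∑_{u<q^(e+1)} (u|q) X^u)·(∑_{t<N} X^{q^(e+1) t}) = ∑_{m < q^(e+1) N} (m|q) X^m`. [folklore] -/
theorem charDigits_mul_topDigits (q e N : ℕ) (hq : 0 < q) :
    (∑ u ∈ Finset.range (q ^ (e + 1)), C ((jacobiSym u q : ℤ) : ℂ) * X ^ u) * (∑ t ∈ Finset.range N, (X : Polynomial ℂ) ^ (q ^ (e + 1) * t)) =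
      ∑ m ∈ Finset.range (q ^ (e + 1) * N), C ((jacobiSym m q : ℤ) : ℂ) * X ^ m := by
  have hQ : 0 < q ^ (e + 1) := pow_pos hq _
  rw [Finset.sum_mul_sum, ← Finset.sum_product']
  refine Finset.sum_nbij' (fun x => x.1 + q ^ (e + 1) * x.2) (fun m => (m % q ^ (e + 1), m / q ^ (e + 1)))
    ?_ ?_ ?_ ?_ ?_
  · rintro ⟨u, t⟩ h
    simp only [Finset.mem_product, Finset.mem_range] at h ⊢
    have key : q ^ (e + 1) * t + q ^ (e + 1) ≤ q ^ (e + 1) * N := by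
      rw [← Nat.mul_succ]; exact Nat.mul_le_mul_left _ h.2
    omega
  · intro m hm
    simp only [Finset.mem_range, Finset.mem_product] at hm ⊢
    exact ⟨Nat.mod_lt _ hQ, (Nat.div_lt_iff_lt_mul hQ).2 (by rwa [mul_comm] at hm)⟩
  · rintro ⟨u, t⟩ h
    simp only [Finset.mem_product, Finset.mem_range] at h
    show ((u + q ^ (e + 1) * t) % q ^ (e + 1), (u + q ^ (e + 1) * t) / q ^ (e + 1)) = (u, t)
    rw [Nat.add_mul_mod_self_left, Nat.mod_eq_of_lt h.1, Nat.add_mul_div_left _ _ hQ,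
      Nat.div_eq_of_lt h.1, zero_add]
  · intro m _
    exact Nat.mod_add_div m (q ^ (e + 1))
  · rintro ⟨u, t⟩ h
    simp only [Finset.mem_product, Finset.mem_range] at h
    have hJ : jacobiSym ((u + q ^ (e + 1) * t : ℕ) : ℤ) q = jacobiSym (u : ℤ) q := by
      rw [jacobiSym.mod_left, jacobiSym.mod_left (u : ℤ) q]
      congr 1
      push_cast
      rw [show (q : ℤ) ^ (e + 1) * (t : ℤ) = (q : ℤ) * ((q : ℤ) ^ e * t) by ring,
        Int.add_mul_emod_self_left]
    show C ((jacobiSym (u : ℕ) q : ℤ) : ℂ) * X ^ u * X ^ (q ^ (e + 1) * t)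
      = C ((jacobiSym ((u + q ^ (e + 1) * t : ℕ) : ℤ) q : ℤ) : ℂ) * X ^ (u + q ^ (e + 1) * t)
    rw [hJ, mul_assoc, ← pow_add]

/-- **Digit splitting at an odd prime power.** `∑_{m<q^(2j+1)} (m|q^(2j+1)) X^m =
(∑_{u<q^(j+1)} (u|q) X^u) · (∑_{t<q^j} X^{q^(j+1) t})` — two factors of sparsity `≤ q^(j+1)` and `≤ q^j`.
[folklore] -/
theorem odd_prime_pow_digit_split (q j : ℕ) (hq : 0 < q) :
    (∑ m ∈ Finset.range (q ^ (2 * j + 1)), C ((jacobiSym m (q ^ (2 * j + 1)) : ℤ) : ℂ) * X ^ m) =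
      (∑ u ∈ Finset.range (q ^ (j + 1)), C ((jacobiSym u q : ℤ) : ℂ) * X ^ u) * (∑ t ∈ Finset.range (q ^ j), (X : Polynomial ℂ) ^ (q ^ (j + 1) * t)) := by
  rw [charDigits_mul_topDigits q j (q ^ j) hq, ← pow_add, show j + 1 + j = 2 * j + 1 by ring]
  refine Finset.sum_congr rfl fun m _ => ?_
  rw [jacobiSym_odd_pow]

/-- Degree of the character-digit factor. [folklore] -/
theorem natDegree_charDigits_lt (q e : ℕ) (hq : 0 < q) : (∑ u ∈ Finset.range (q ^ (e + 1)), C ((jacobiSym u q : ℤ) : ℂ) * X ^ u).natDegree < q ^ (e + 1) := by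
  have hQ : 0 < q ^ (e + 1) := pow_pos hq _
  refine lt_of_le_of_lt (natDegree_sum_le_of_forall_le _ _ (n := q ^ (e + 1) - 1) fun u hu => ?_) (by omega)
  exact (natDegree_C_mul_X_pow_le _ _).trans (by have := Finset.mem_range.1 hu; omega)

/-- Sparsity of the character-digit factor. [folklore] -/
theorem card_support_charDigits_le (q e : ℕ) (hq : 0 < q) : (∑ u ∈ Finset.range (q ^ (e + 1)), C ((jacobiSym u q : ℤ) : ℂ) * X ^ u).support.card ≤ q ^ (e + 1) :=
  calc (∑ u ∈ Finset.range (q ^ (e + 1)), C ((jacobiSym u q : ℤ) : ℂ) * X ^ u).support.card ≤ (Finset.range (q ^ (e + 1))).card :=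
        Finset.card_le_card (supp_subset_range (natDegree_charDigits_lt q e hq))
    _ = q ^ (e + 1) := Finset.card_range _

/-- Sparsity of the top-digit factor. [folklore] -/
theorem card_support_topDigits_le (q e N : ℕ) : (∑ t ∈ Finset.range N, (X : Polynomial ℂ) ^ (q ^ (e + 1) * t)).support.card ≤ N := by
  have hsub : (∑ t ∈ Finset.range N, (X : Polynomial ℂ) ^ (q ^ (e + 1) * t)).support ⊆ (Finset.range N).image (fun t => q ^ (e + 1) * t) := by
    intro n hn
    rw [mem_support_iff] at hn
    by_contra h
    apply hn
    simp only [finsetSum_coeff, coeff_X_pow]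
    refine Finset.sum_eq_zero fun t ht => ?_
    rw [if_neg]
    rintro rfl
    exact h (Finset.mem_image.2 ⟨t, ht, rfl⟩)
  exact (Finset.card_le_card hsub).trans (Finset.card_image_le.trans (by simp))

/-- Degree of the top-digit factor. [folklore] -/
theorem natDegree_topDigits_le (q e N : ℕ) : (∑ t ∈ Finset.range N, (X : Polynomial ℂ) ^ (q ^ (e + 1) * t)).natDegree ≤ q ^ (e + 1) * N := by
  refine natDegree_sum_le_of_forall_le _ _ fun t ht => ?_
  rw [natDegree_X_pow]
  exact Nat.mul_le_mul_left _ (Finset.mem_range.1 ht).le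

/-- An odd prime has a quadratic non-residue: its character is non-principal. [folklore] -/
theorem exists_jacobiSym_eq_neg_one (q : ℕ) [Fact q.Prime] (hq2 : q ≠ 2) :
    ∃ m : ℕ, jacobiSym m q = -1 := by
  have hchar : ringChar (ZMod q) ≠ 2 := by rw [ZMod.ringChar_zmod_n]; exact hq2
  obtain ⟨a, ha⟩ := FiniteField.exists_nonsquare hchar
  refine ⟨a.val, ?_⟩
  rw [← jacobiSym.legendreSym.to_jacobiSym]
  show quadraticChar (ZMod q) (((a.val : ℕ) : ℤ) : ZMod q) = -1
  rw [Int.cast_natCast, ZMod.natCast_zmod_val]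
  exact quadraticChar_neg_one_iff_not_isSquare.2 ha

/-- The non-principal odd-modulus δ-slice still implies X's δ-slice (primes `≥ 3` are odd with a
non-residue), so refuting it refutes a genuine STRENGTHENING of X. [folklore] -/
theorem nonprincipal_slice_to_legendre_slice {δ : ℝ}
    (h : ∃ p₀ : ℕ, ∀ p : ℕ, Odd p → (∃ m : ℕ, jacobiSym m p = -1) → p₀ ≤ p →
      ∀ (s : ℕ) (c : Fin s → ℂ) (g : Fin s → Polynomial ℂ),
      (s : ℝ) ≤ (p : ℝ) ^ δ → (∀ i, (g i).natDegree ≤ p ^ 2) →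
      (∑ i, C (c i) * g i ^ 2) = ∑ m ∈ Finset.range p, C ((jacobiSym m p : ℤ) : ℂ) * X ^ m →
      (p : ℝ) ^ (1 / 2 + δ) ≤ ∑ i, ((g i).support.card : ℝ)) :
    ∃ p₀ : ℕ, ∀ (p : ℕ) [Fact p.Prime], p₀ ≤ p → ∀ (s : ℕ) (c : Fin s → ℂ) (g : Fin s → Polynomial ℂ),
      (s : ℝ) ≤ (p : ℝ) ^ δ → (∀ i, (g i).natDegree ≤ p ^ 2) →
      (∑ i, C (c i) * g i ^ 2) = ∑ m ∈ Finset.range p, C ((legendreSym p m : ℤ) : ℂ) * X ^ m →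
      (p : ℝ) ^ (1 / 2 + δ) ≤ ∑ i, ((g i).support.card : ℝ) := by
  obtain ⟨p₀, H⟩ := h
  refine ⟨max p₀ 3, fun p _ hp s c g hs hdeg hrep => ?_⟩
  have hprime : p.Prime := Fact.out
  have hp3 : 3 ≤ p := le_trans (le_max_right _ _) hp
  have hodd : Odd p := hprime.odd_of_ne_two (by omega)
  refine H p hodd (exists_jacobiSym_eq_neg_one p (by omega)) (le_trans (le_max_left _ _) hp) s c g hs hdeg
    (hrep.trans ?_)
  refine Finset.sum_congr rfl fun m _ => ?_
  rw [jacobiSym.legendreSym.to_jacobiSym]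

/-- **Imprimitive non-principal characters are SOS-easy at every δ > 0.** The δ-slice of X over odd
moduli with NON-PRINCIPAL Jacobi character fails for every `δ > 0`: given `δ` take `j` with `2jδ ≥ 1` and a
prime `q ≥ 17`; the odd modulus `p = q^(2j+1)` carries the non-principal character `(·|q)` and
`F_p = U·V` (`odd_prime_pow_digit_split`), so `F_p = ¼(U+V)² − ¼(U−V)²` has `s = 2 ≤ q ≤ p^δ` squares of
degree `≤ p` and support-sum `≤ 4q^(j+1) < q^(j+1)·q^(1/2) ≤ q^(j+1)·q^((2j+1)δ−1/2) = p^(1/2+δ)`. [folklore] -/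
theorem feketeSOSHard_slice_false_nonprincipal {δ : ℝ} (hδ : 0 < δ) :
    ¬ (∃ p₀ : ℕ, ∀ p : ℕ, Odd p → (∃ m : ℕ, jacobiSym m p = -1) → p₀ ≤ p →
      ∀ (s : ℕ) (c : Fin s → ℂ) (g : Fin s → Polynomial ℂ),
      (s : ℝ) ≤ (p : ℝ) ^ δ → (∀ i, (g i).natDegree ≤ p ^ 2) →
      (∑ i, C (c i) * g i ^ 2) = ∑ m ∈ Finset.range p, C ((jacobiSym m p : ℤ) : ℂ) * X ^ m →
      (p : ℝ) ^ (1 / 2 + δ) ≤ ∑ i, ((g i).support.card : ℝ)) := by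
  rintro ⟨p₀, H⟩
  -- the exponent j with 2jδ ≥ 1
  set j : ℕ := ⌈1 / (2 * δ)⌉₊ with hj
  have h2δ : 0 < 2 * δ := by linarith
  have hjδ : 1 ≤ 2 * (j : ℝ) * δ := by
    have h1 : 1 / (2 * δ) ≤ (j : ℝ) := Nat.le_ceil _
    calc (1 : ℝ) = (1 / (2 * δ)) * (2 * δ) := by field_simp
      _ ≤ (j : ℝ) * (2 * δ) := mul_le_mul_of_nonneg_right h1 h2δ.le
      _ = 2 * (j : ℝ) * δ := by ring
  -- a prime q ≥ 17
  obtain ⟨q, hq_ge, hq_prime⟩ := Nat.exists_infinite_primes (max p₀ 17)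
  haveI : Fact q.Prime := ⟨hq_prime⟩
  have hp₀q : p₀ ≤ q := le_trans (le_max_left _ _) hq_ge
  have h17 : 17 ≤ q := le_trans (le_max_right _ _) hq_ge
  have hq_pos : (0 : ℝ) < q := by exact_mod_cast hq_prime.pos
  have hq1 : (1 : ℝ) ≤ q := by exact_mod_cast hq_prime.one_lt.le
  have hqpos : 0 < q := hq_prime.pos
  -- the modulus p = q^(2j+1)
  set p : ℕ := q ^ (2 * j + 1) with hp
  have hodd : Odd p := by rw [hp]; exact (hq_prime.odd_of_ne_two (by omega)).pow
  have hnp : ∃ m : ℕ, jacobiSym m p = -1 := by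
    obtain ⟨m, hm⟩ := exists_jacobiSym_eq_neg_one q (by omega)
    exact ⟨m, by rw [hp, jacobiSym_odd_pow, hm]⟩
  have hqp : q ≤ p := by rw [hp]; exact Nat.le_self_pow (by omega) q
  have hp₀' : p₀ ≤ p := hp₀q.trans hqp
  have hcast : (p : ℝ) = (q : ℝ) ^ ((2 * j + 1 : ℕ) : ℝ) := by
    rw [Real.rpow_natCast, hp]; push_cast; ring
  -- the exponent gap B = (2j+1)δ − 1/2 ≥ 1/2
  set B : ℝ := ((2 * j + 1 : ℕ) : ℝ) * δ - 1 / 2 with hBdef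
  have hB : (1 : ℝ) / 2 ≤ B := by
    rw [hBdef]; push_cast; nlinarith
  have hsqrt : (4 : ℝ) < (q : ℝ) ^ (1 / 2 : ℝ) := by
    have hsq : ((q : ℝ) ^ (1 / 2 : ℝ)) ^ (2 : ℕ) = q := by
      rw [← Real.rpow_mul_natCast hq_pos.le]; norm_num
    refine lt_of_pow_lt_pow_left₀ 2 (by positivity) ?_
    rw [hsq]
    have : (17 : ℝ) ≤ q := by exact_mod_cast h17
    linarith
  have hqB : (4 : ℝ) < (q : ℝ) ^ B := hsqrt.trans_le (Real.rpow_le_rpow_of_exponent_le hq1 hB)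
  -- (1) two squares are admitted: 2 ≤ q ≤ p^δ
  have hs : ((2 : ℕ) : ℝ) ≤ (p : ℝ) ^ δ := by
    rw [hcast, ← Real.rpow_mul hq_pos.le]
    have hexp : (1 : ℝ) ≤ ((2 * j + 1 : ℕ) : ℝ) * δ := by push_cast; nlinarith
    calc ((2 : ℕ) : ℝ) ≤ (q : ℝ) := by exact_mod_cast (show 2 ≤ q by omega)
      _ = (q : ℝ) ^ (1 : ℝ) := (Real.rpow_one _).symm
      _ ≤ (q : ℝ) ^ (((2 * j + 1 : ℕ) : ℝ) * δ) := Real.rpow_le_rpow_of_exponent_le hq1 hexp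
  -- the representation
  set U : Polynomial ℂ := ∑ u ∈ Finset.range (q ^ (j + 1)), C ((jacobiSym u q : ℤ) : ℂ) * X ^ u with hU
  set V : Polynomial ℂ := ∑ t ∈ Finset.range (q ^ j), (X : Polynomial ℂ) ^ (q ^ (j + 1) * t) with hV
  have hprod : U * V = ∑ m ∈ Finset.range p, C ((jacobiSym m p : ℤ) : ℂ) * X ^ m := by
    rw [hp, odd_prime_pow_digit_split q j hqpos]
  have hrep : (∑ i, C ((![(4 : ℂ)⁻¹, -(4 : ℂ)⁻¹]) i) * (![U + V, U - V]) i ^ 2) =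
      ∑ m ∈ Finset.range p, C ((jacobiSym m p : ℤ) : ℂ) * X ^ m := by
    simp only [Fin.sum_univ_two, Matrix.cons_val_zero, Matrix.cons_val_one]
    have h4 : (C (4 : ℂ)⁻¹ : Polynomial ℂ) * 4 = 1 := by
      rw [← map_ofNat C 4, ← C_mul, inv_mul_cancel₀ (by norm_num), C_1]
    rw [← hprod]
    have : C (4 : ℂ)⁻¹ * (U + V) ^ 2 + C (-(4 : ℂ)⁻¹) * (U - V) ^ 2 = C (4 : ℂ)⁻¹ * 4 * (U * V) := by
      rw [map_neg]; ring
    rw [this, h4, one_mul]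
  have hdeg : ∀ i : Fin 2, ((![U + V, U - V]) i).natDegree ≤ p ^ 2 := by
    have hU' : U.natDegree ≤ p := by
      have h1 : U.natDegree < q ^ (j + 1) := natDegree_charDigits_lt q j hqpos
      have h2 : q ^ (j + 1) ≤ p := by rw [hp]; exact Nat.pow_le_pow_right hqpos (by omega)
      omega
    have hV' : V.natDegree ≤ p := by
      have h1 : V.natDegree ≤ q ^ (j + 1) * q ^ j := natDegree_topDigits_le q j (q ^ j)
      have h2 : q ^ (j + 1) * q ^ j = p := by rw [hp, ← pow_add]; congr 1; ring
      omega
    have hpp : p ≤ p ^ 2 := Nat.le_self_pow two_ne_zero p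
    have h₁ : (U + V).natDegree ≤ p ^ 2 :=
      (natDegree_add_le _ _).trans (max_le (hU'.trans hpp) (hV'.trans hpp))
    have h₂ : (U - V).natDegree ≤ p ^ 2 :=
      (natDegree_sub_le _ _).trans (max_le (hU'.trans hpp) (hV'.trans hpp))
    intro i
    fin_cases i
    · exact h₁
    · exact h₂
  have key := H p hodd hnp hp₀' 2 (![(4 : ℂ)⁻¹, -(4 : ℂ)⁻¹]) (![U + V, U - V]) hs hdeg hrep
  -- (2) support-sum ≤ 2(q^(j+1) + q^j) ≤ 4 q^(j+1)
  have hcardU : (U.support.card : ℝ) ≤ (q : ℝ) ^ (j + 1) := by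
    exact_mod_cast card_support_charDigits_le q j hqpos
  have hcardV : (V.support.card : ℝ) ≤ (q : ℝ) ^ (j + 1) := by
    have h1 : (V.support.card : ℝ) ≤ (q : ℝ) ^ j := by
      exact_mod_cast card_support_topDigits_le q j (q ^ j)
    have h2 : (q : ℝ) ^ j ≤ (q : ℝ) ^ (j + 1) := pow_le_pow_right₀ hq1 (by omega)
    linarith
  have hUV₁ : (((U + V).support.card : ℕ) : ℝ) ≤ U.support.card + V.support.card := by
    exact_mod_cast (Finset.card_le_card support_add).trans (Finset.card_union_le _ _)
  have hUV₂ : (((U - V).support.card : ℕ) : ℝ) ≤ U.support.card + V.support.card := by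
    have hsub : (U - V).support ⊆ U.support ∪ V.support := by
      rw [sub_eq_add_neg]
      refine support_add.trans ?_
      rw [support_neg]
    exact_mod_cast (Finset.card_le_card hsub).trans (Finset.card_union_le _ _)
  have hsum : (∑ i : Fin 2, ((((![U + V, U - V]) i).support.card : ℝ))) ≤ 4 * (q : ℝ) ^ (j + 1) := by
    simp only [Fin.sum_univ_two, Matrix.cons_val_zero, Matrix.cons_val_one]
    linarith
  -- (3) 4 q^(j+1) < p^(1/2+δ) = q^(j+1) · q^B
  have hlt : (4 : ℝ) * (q : ℝ) ^ (j + 1) < (p : ℝ) ^ (1 / 2 + δ) := by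
    rw [hcast, ← Real.rpow_mul hq_pos.le,
      show ((2 * j + 1 : ℕ) : ℝ) * (1 / 2 + δ) = ((j + 1 : ℕ) : ℝ) + B by rw [hBdef]; push_cast; ring,
      Real.rpow_add hq_pos, Real.rpow_natCast]
    calc (4 : ℝ) * (q : ℝ) ^ (j + 1) = (q : ℝ) ^ (j + 1) * 4 := by ring
      _ < (q : ℝ) ^ (j + 1) * (q : ℝ) ^ B := mul_lt_mul_of_pos_left hqB (by positivity)
  linarith

end Summit.ValiantsHypothesis.ValiantsHypothesis.Theorems.SOSMagnification.Negative
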